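import Summits.RiemannHypothesis.RiemannHypothesis.Theses.IntegerScrew
import Summits.RiemannHypothesis.RiemannHypothesis.Theorems.WeilCombCombSubcritical
import Summits.RiemannHypothesis.RiemannHypothesis.Theorems.WeilCombCombHelsonBound
import Summits.RiemannHypothesis.RiemannHypothesis.Theorems.IntegerScrewDiscreteLandau
import Summits.RiemannHypothesis.RiemannHypothesis.Theorems.IntegerScrewScrewDensityDetection
import Literature.NumberTheory.LFunctions.ZetaScrewThm12Proofs
import Literature.NumberTheory.LFunctions.ZetaScrewSeriesProofs
import Literature.NumberTheory.LFunctions.WeilExplicitFormulaProofs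
import Literature.NumberTheory.LFunctions.WeilExplicitProofs
import Literature.NumberTheory.LFunctions.WeilLogLatticeComb
import HarnessLib

/-!
# Route IntegerScrew — `FloorOfRH` (item stmt-RiemannHypothesis-15762) PROVED:
# the polynomial floor for the screw-kernel Gram matrices holds under RH

`FloorOfRH : RiemannHypothesis → ∃ A c > 0, ∀ M x, c·M^{−A}·Σ_{2≤m≤M} x_m² ≤ Σ_{2≤m,m'≤M} G(log m, log m') x_m x_m'`
(`G = zetaScrewKernel`, Suzuki's Kreĭn kernel of `Ψ = zetaScrew`).  This is the floor-law half of the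
crux `ScrewPolyFloor` (stmt-RiemannHypothesis-15757; `ScrewPolyFloor ↔ RH ∧ FloorOfRH`, see
`IntegerScrewScrewPolyFloorSplit.lean`), i.e. line `weil_comb_floor` of that crux with every floor-law
stub discharged.

Proof (crux-strategist line `weil-comb-floor`, all inputs theorems of the tree):
* **zero side of the screw form** (unconditional): from Suzuki 2023 Thm 1.1(2)
  (`Suzuki2023_thm11_series_holds`) and the algebra `cosh(s(A−B)) = cosh sA cosh sB − sinh sA sinh sB`,
  for real `y` with `Σ_{m ≤ M} y_m = 0`:
  `Σ_{2≤a,b≤M} G(log a, log b) y_a y_b = Σ_ρ m(ρ)·(−P_y(ρ−½)P_y(½−ρ))/(ρ−½)²`, `P_y(s) = Σ_{m≤M} y_m m^s`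
  (`hasSum_screwForm`); under RH each term is `m(ρ)|P_y(iγ)|²/γ² ≥ 0` (`hasSum_zeroWeight`);
* **zero side of the comb** `g = Σ_m y_m ε⁻¹φ((·−log m)/ε)`: `ĝ(s) = φ̂(½ + (s−½)ε)·P_y(s−½)`
  (`weilMellin_comb`, from `weilMellin_tooth`), `(g⋆g̃)^(ρ) = |ĝ(ρ)|²` on the line
  (`weilMellin_weilQuadratic_of_re_eq`), `|φ̂(½+iγε)| ≤ ‖φ'‖₁'/(|γ|ε)`
  (`norm_weilMellin_le_weilL1_iterate_deriv_div`), so every truncated zero side of `Q(g)` is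
  `≤ ‖φ'‖₁'²ε⁻²·(screw form)` and `explicit_formula_holds` passes to the limit (`combDominated`);
* **WeilComb's Theorem-A machinery**: `analyticReduction` (Theorems/WeilCombCombSubcritical) bounds
  `Re Q(g)` below by `ε⁻¹‖φ‖₂²[(log(1/ε) − C)‖y‖² − Helson_Λ(y) − ε·archShadow(y)]` for `8εM ≤ 1`,
  `combHelsonBound_proof` bounds the Helson form by `(log M + 1)‖y‖²`, the shadow is `≤ 12M²‖y‖²`
  (`shadowBudget_proof`), a concrete bump exists (`bumpWitness_proof`), and `ε = M^{−K}` with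
  `K = max 4 (⌈(C+4)/log 2⌉₊ + 2)` gives the floor `c·M^{−K}`, `c = (‖φ‖₂²/‖φ'‖₁'²)·log 2`
  (`endgameComb_proof`).

Consequences (last section): with the landed `DiscreteLandau_proof` (crux 3) and
`screwDensityDetection_proof`, the crux `ScrewPolyFloor` of the route is now FORMALLY the route target /
the summit: `screwPolyFloor_iff_riemannHypothesis : ScrewPolyFloor ↔ RiemannHypothesis` and
`screwPolyFloor_iff_target : ScrewPolyFloor ↔ IntegerScrewPSD`.

Unconditional (the statement is an implication from RH); standard axioms; no `sorry`.
-/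

noncomputable section

-- `Summit.RiemannHypothesis.RiemannHypothesis.…` duplicates `RiemannHypothesis` BY DESIGN (D-0017).
set_option linter.dupNamespace false

namespace Summit.RiemannHypothesis.RiemannHypothesis.Theorems.IntegerScrewFloorOfRH

open Literature.NumberTheory.LFunctions MeasureTheory Filter
open scoped BigOperators ComplexConjugate Topology
open Finset Complex

/-! ## Objects -/

/-- WeilComb's log-integer comb with real coefficients `y` (verbatim the function of
`WeilComb.CombSubcritical` / `analyticReduction` at `a m := (y m : ℂ)`):
`x ↦ Σ_{1 ≤ m ≤ M} y_m · ε⁻¹ φ((x − log m)/ε)`. -/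
def comb (φ : ℝ → ℂ) (ε : ℝ) (M : ℕ) (y : ℕ → ℝ) : ℝ → ℂ :=
  fun x => ∑ m ∈ Icc 1 M, ((y m : ℝ) : ℂ) * ((ε : ℂ)⁻¹ * φ ((x - Real.log (m : ℝ)) / ε))

/-- `‖y‖²_M` in the shape produced by `analyticReduction` (`Σ ‖(y m : ℂ)‖²`). -/
def l2 (M : ℕ) (y : ℕ → ℝ) : ℝ :=
  ∑ m ∈ Icc 1 M, ‖((y m : ℝ) : ℂ)‖ ^ 2

/-- The von Mangoldt Helson form (verbatim `CombHelsonBound`'s left side at `a m := (y m : ℂ)`). -/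
def helson (M : ℕ) (y : ℕ → ℝ) : ℝ :=
  2 * (∑ m ∈ Icc 1 M, ∑ n ∈ Icc 1 (M / m),
    ((ArithmeticFunction.vonMangoldt n : ℝ) : ℂ) / (Real.sqrt n : ℂ) * ((y (n * m) : ℝ) : ℂ) *
      conj ((y m : ℝ) : ℂ)).re

/-- The archimedean shadow of `analyticReduction` (verbatim at `a m := (y m : ℂ)`):
`5 A₋A₊ + 2·(log-Hilbert off-diagonal) + 2 (Σ|y|)²`. -/
def archShadow (M : ℕ) (y : ℕ → ℝ) : ℝ :=
  5 * (∑ m ∈ Icc 1 M, ‖((y m : ℝ) : ℂ)‖ / Real.sqrt m) *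
      (∑ m ∈ Icc 1 M, ‖((y m : ℝ) : ℂ)‖ * Real.sqrt m) +
    2 * (∑ m ∈ Icc 1 M, ∑ m' ∈ (Icc 1 M).erase m,
      ‖((y m : ℝ) : ℂ)‖ * ‖((y m' : ℝ) : ℂ)‖ / |Real.log m - Real.log m'|) +
    2 * (∑ m ∈ Icc 1 M, ‖((y m : ℝ) : ℂ)‖) ^ 2

/-- The screw quadratic form of the crux on `{2, …, M}`. -/
def screwForm (M : ℕ) (y : ℕ → ℝ) : ℝ :=
  ∑ m ∈ Icc 2 M, ∑ m' ∈ Icc 2 M, zetaScrewKernel (Real.log m) (Real.log m') * (y m * y m')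

/-! ## The four floor-law statements (named) -/

namespace Sig

/-- S3: under RH the comb's Weil form is dominated by `‖φ'‖₁'² ε⁻²` times the screw form. -/
def stub_combDominated : Prop :=
  _root_.RiemannHypothesis → ∀ φ : ℝ → ℂ, IsWeilTest φ →
    ∀ (M : ℕ) (ε : ℝ) (y : ℕ → ℝ), 1 ≤ M → 0 < ε → ∑ m ∈ Icc 1 M, y m = 0 →
      (weilQuadratic (comb φ ε M y)).re ≤ weilL1 (deriv φ) ^ 2 * ε⁻¹ ^ 2 * screwForm M y

/-- S4: one admissible bump. -/
def stub_bumpWitness : Prop :=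
  ∃ φ : ℝ → ℂ, IsWeilTest φ ∧ tsupport φ ⊆ Set.Icc (-1) 1 ∧ 0 < weilNorm2Sq φ ∧
    0 < weilL1 (deriv φ)

/-- S5: the archimedean shadow is polynomially bounded. -/
def stub_shadowBudget : Prop :=
  ∀ (M : ℕ) (y : ℕ → ℝ), 1 ≤ M → archShadow M y ≤ 12 * (M : ℝ) ^ 2 * l2 M y

/-- S6: the parameter choice `ε = M^{-K}` (pure real analysis). -/
def stub_endgameComb : Prop :=
  ∀ (C N B : ℝ), 0 < N → 0 < B → ∃ (K : ℕ) (A c : ℝ), 0 < c ∧ ∀ M : ℕ, 2 ≤ M →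
    8 * ((M : ℝ) ^ K)⁻¹ * M ≤ 1 ∧
      c * (M : ℝ) ^ (-A) ≤
        ((M : ℝ) ^ K)⁻¹ * N / B *
          (Real.log (1 / ((M : ℝ) ^ K)⁻¹) - C - (Real.log M + 1) -
            ((M : ℝ) ^ K)⁻¹ * (12 * (M : ℝ) ^ 2))

end Sig

/-! ## S4–S6: bump witness, shadow budget, endgame -/

/-- A smooth bump: `1` on `[-1/2, 1/2]`, supported in `[-1, 1]`. -/
def witnessBump : ContDiffBump (0 : ℝ) := ⟨1 / 2, 1, by norm_num, by norm_num⟩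

/-- The test function of the witness. -/
def witnessFun (t : ℝ) : ℂ := ((witnessBump t : ℝ) : ℂ)

theorem witnessFun_eq : witnessFun = fun t => ((witnessBump t : ℝ) : ℂ) := rfl

theorem contDiff_witnessFun : ContDiff ℝ (⊤ : ℕ∞) witnessFun :=
  Complex.ofRealCLM.contDiff.comp witnessBump.contDiff

theorem hasCompactSupport_witnessFun : HasCompactSupport witnessFun :=
  witnessBump.hasCompactSupport.comp_left Complex.ofReal_zero

theorem isWeilTest_witnessFun : IsWeilTest witnessFun := ⟨contDiff_witnessFun, hasCompactSupport_witnessFun⟩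

theorem tsupport_witnessFun : tsupport witnessFun ⊆ Set.Icc (-1) 1 := by
  have h1 : tsupport witnessFun ⊆ tsupport (witnessBump : ℝ → ℝ) :=
    tsupport_comp_subset Complex.ofReal_zero _
  have h2 : tsupport (witnessBump : ℝ → ℝ) = Metric.closedBall 0 1 := witnessBump.tsupport_eq
  rw [h2, Real.closedBall_eq_Icc, zero_sub, zero_add] at h1
  exact h1

theorem continuous_witnessFun : Continuous witnessFun := contDiff_witnessFun.continuous

theorem witnessFun_zero : witnessFun 0 = 1 := by
  have : (witnessBump : ℝ → ℝ) 0 = 1 := witnessBump.one_of_mem_closedBall (by simp [witnessBump])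
  simp [witnessFun, this]

/-- `‖witnessFun‖₂² > 0`. -/
theorem weilNorm2Sq_witnessFun_pos : 0 < weilNorm2Sq witnessFun := by
  unfold weilNorm2Sq
  have hcont : Continuous fun x : ℝ => ‖witnessFun x‖ ^ 2 := (continuous_witnessFun.norm).pow 2
  have hsupp : HasCompactSupport fun x : ℝ => ‖witnessFun x‖ ^ 2 := by
    refine hasCompactSupport_witnessFun.norm.comp_left (g := fun r : ℝ => r ^ 2) ?_
    simp
  have hint : Integrable fun x : ℝ => ‖witnessFun x‖ ^ 2 := hcont.integrable_of_hasCompactSupport hsupp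
  have hnn : 0 ≤ fun x : ℝ => ‖witnessFun x‖ ^ 2 := fun x => by positivity
  rw [integral_pos_iff_support_of_nonneg hnn hint]
  have hopen : IsOpen (Function.support fun x : ℝ => ‖witnessFun x‖ ^ 2) := hcont.isOpen_support
  have hmem : (0 : ℝ) ∈ Function.support fun x : ℝ => ‖witnessFun x‖ ^ 2 := by
    rw [Function.mem_support, witnessFun_zero]
    simp
  exact hopen.measure_pos volume ⟨0, hmem⟩

/-- The derivative of `witnessFun` is the (real) derivative of the bump, cast to `ℂ`. -/
theorem deriv_witnessFun (t : ℝ) : deriv witnessFun t = ((deriv (witnessBump : ℝ → ℝ) t : ℝ) : ℂ) := by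
  have hd : HasDerivAt (witnessBump : ℝ → ℝ) (deriv (witnessBump : ℝ → ℝ) t) t :=
    ((witnessBump.contDiff (n := ⊤)).differentiable (by simp)).differentiableAt.hasDerivAt
  exact (hd.ofReal_comp).deriv

/-- Some point where the bump has non-zero derivative (mean value theorem between `0` and `2`). -/
theorem exists_deriv_witnessBump_ne_zero : ∃ ξ : ℝ, deriv (witnessBump : ℝ → ℝ) ξ ≠ 0 := by
  have hdiff : Differentiable ℝ (witnessBump : ℝ → ℝ) := (witnessBump.contDiff (n := ⊤)).differentiable (by simp)
  obtain ⟨ξ, -, hξ⟩ := exists_deriv_eq_slope (witnessBump : ℝ → ℝ) (by norm_num : (0 : ℝ) < 2)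
    hdiff.continuous.continuousOn (hdiff.differentiableOn)
  refine ⟨ξ, ?_⟩
  have h0 : (witnessBump : ℝ → ℝ) 0 = 1 := witnessBump.one_of_mem_closedBall (by simp [witnessBump])
  have h2 : (witnessBump : ℝ → ℝ) 2 = 0 := witnessBump.zero_of_le_dist (by simp [witnessBump])
  rw [hξ, h0, h2]
  norm_num

/-- `∫ ‖witnessFun'‖ e^{|t|/2} > 0`. -/
theorem weilL1_deriv_witnessFun_pos : 0 < weilL1 (deriv witnessFun) := by
  unfold weilL1
  have hderiv : deriv witnessFun = fun t => ((deriv (witnessBump : ℝ → ℝ) t : ℝ) : ℂ) := funext deriv_witnessFun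
  have hcontb : Continuous (deriv (witnessBump : ℝ → ℝ)) :=
    (witnessBump.contDiff (n := ⊤)).continuous_deriv (by simp)
  have hcont : Continuous fun t : ℝ => ‖deriv witnessFun t‖ * Real.exp (|t| / 2) := by
    rw [hderiv]
    exact (Complex.continuous_ofReal.comp hcontb).norm.mul (by fun_prop)
  have hsuppd : HasCompactSupport (deriv witnessFun) := hasCompactSupport_witnessFun.deriv
  have hsupp : HasCompactSupport fun t : ℝ => ‖deriv witnessFun t‖ * Real.exp (|t| / 2) :=
    (hsuppd.norm).mul_right
  have hint : Integrable fun t : ℝ => ‖deriv witnessFun t‖ * Real.exp (|t| / 2) :=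
    hcont.integrable_of_hasCompactSupport hsupp
  have hnn : 0 ≤ fun t : ℝ => ‖deriv witnessFun t‖ * Real.exp (|t| / 2) := fun t => by positivity
  rw [integral_pos_iff_support_of_nonneg hnn hint]
  have hopen : IsOpen (Function.support fun t : ℝ => ‖deriv witnessFun t‖ * Real.exp (|t| / 2)) :=
    hcont.isOpen_support
  obtain ⟨ξ, hξ⟩ := exists_deriv_witnessBump_ne_zero
  have hmem : ξ ∈ Function.support fun t : ℝ => ‖deriv witnessFun t‖ * Real.exp (|t| / 2) := by
    rw [Function.mem_support, deriv_witnessFun]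
    have : ‖((deriv (witnessBump : ℝ → ℝ) ξ : ℝ) : ℂ)‖ ≠ 0 := by
      rw [Complex.norm_real, norm_ne_zero_iff]
      exact hξ
    exact mul_ne_zero this (Real.exp_pos _).ne'
  exact hopen.measure_pos volume ⟨ξ, hmem⟩

/-- **S4 PROVED** (was `stub_bumpWitness`): the witness bump. -/
theorem bumpWitness_proof : Sig.stub_bumpWitness :=
  ⟨witnessFun, isWeilTest_witnessFun, tsupport_witnessFun, weilNorm2Sq_witnessFun_pos,
    weilL1_deriv_witnessFun_pos⟩

/-! ### S5: the archimedean shadow budget -/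

/-- Cauchy–Schwarz on `Icc 1 M`: `(Σ a)² ≤ M · Σ a²`. -/
theorem sq_sum_Icc_le (M : ℕ) (a : ℕ → ℝ) :
    (∑ m ∈ Icc 1 M, a m) ^ 2 ≤ (M : ℝ) * ∑ m ∈ Icc 1 M, a m ^ 2 := by
  have h := sq_sum_le_card_mul_sum_sq (s := Icc 1 M) (f := a)
  simpa [Nat.card_Icc] using h

/-- For `1 ≤ m' < m ≤ M`: `1/M ≤ log m − log m'`. -/
theorem inv_le_log_sub_log {M m m' : ℕ} (hm' : 1 ≤ m') (hlt : m' < m) (hmM : m ≤ M) :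
    (1 : ℝ) / M ≤ Real.log m - Real.log m' := by
  have hm'pos : (0 : ℝ) < m' := by exact_mod_cast hm'
  have hmpos : (0 : ℝ) < m := by exact_mod_cast (lt_of_lt_of_le hm' (le_of_lt hlt))
  have hMpos : (0 : ℝ) < M := by exact_mod_cast (lt_of_lt_of_le (lt_of_lt_of_le hm' hlt.le) hmM)
  rw [← Real.log_div hmpos.ne' hm'pos.ne']
  have h1 : 1 - ((m : ℝ) / m')⁻¹ ≤ Real.log ((m : ℝ) / m') :=
    Real.one_sub_inv_le_log_of_pos (div_pos hmpos hm'pos)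
  have h2 : (1 : ℝ) / M ≤ 1 - ((m : ℝ) / m')⁻¹ := by
    rw [inv_div]
    have hdiff : (1 : ℝ) ≤ (m : ℝ) - m' := by
      have : m' + 1 ≤ m := hlt
      have : ((m' : ℝ) + 1) ≤ m := by exact_mod_cast this
      linarith
    rw [div_le_iff₀ hMpos, sub_mul, div_mul_eq_mul_div, one_mul]
    rw [le_sub_iff_add_le]
    have hmM' : (m : ℝ) ≤ M := by exact_mod_cast hmM
    have : (m' : ℝ) * M / m ≤ M - 1 := by
      rw [div_le_iff₀ hmpos]
      nlinarith
    linarith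
  exact h2.trans h1

/-- For `m ≠ m'` in `Icc 1 M`: `1/|log m − log m'| ≤ M`. -/
theorem inv_abs_log_sub_log_le {M m m' : ℕ} (hm : m ∈ Icc 1 M) (hm' : m' ∈ Icc 1 M) (hne : m ≠ m') :
    1 / |Real.log m - Real.log m'| ≤ (M : ℝ) := by
  simp only [Finset.mem_Icc] at hm hm'
  have hMpos : (0 : ℝ) < M := by exact_mod_cast (lt_of_lt_of_le hm.1 hm.2)
  rcases lt_or_gt_of_ne hne with hlt | hgt
  · -- m < m'
    have h := inv_le_log_sub_log (M := M) hm.1 hlt hm'.2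
    have hpos : 0 < Real.log m' - Real.log m := lt_of_lt_of_le (by positivity) h
    rw [abs_sub_comm, abs_of_pos hpos, div_le_iff₀ hpos]
    rw [div_le_iff₀ hMpos] at h
    linarith
  · have h := inv_le_log_sub_log (M := M) hm'.1 hgt hm.2
    have hpos : 0 < Real.log m - Real.log m' := lt_of_lt_of_le (by positivity) h
    rw [abs_of_pos hpos, div_le_iff₀ hpos]
    rw [div_le_iff₀ hMpos] at h
    linarith

/-- The three shadow bounds for a non-negative weight `a` on `Icc 1 M`. -/
theorem shadow_le (M : ℕ) (a : ℕ → ℝ) (ha : ∀ m, 0 ≤ a m) (hM : 1 ≤ M) :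
    5 * (∑ m ∈ Icc 1 M, a m / Real.sqrt m) * (∑ m ∈ Icc 1 M, a m * Real.sqrt m) +
        2 * (∑ m ∈ Icc 1 M, ∑ m' ∈ (Icc 1 M).erase m, a m * a m' / |Real.log m - Real.log m'|) +
        2 * (∑ m ∈ Icc 1 M, a m) ^ 2 ≤
      12 * (M : ℝ) ^ 2 * ∑ m ∈ Icc 1 M, a m ^ 2 := by
  have hMr : (1 : ℝ) ≤ M := by exact_mod_cast hM
  have hMpos : (0 : ℝ) < M := by linarith
  set S : ℝ := ∑ m ∈ Icc 1 M, a m with hS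
  set L : ℝ := ∑ m ∈ Icc 1 M, a m ^ 2 with hL
  have hS0 : 0 ≤ S := Finset.sum_nonneg fun m _ => ha m
  have hL0 : 0 ≤ L := Finset.sum_nonneg fun m _ => sq_nonneg _
  have hCS : S ^ 2 ≤ (M : ℝ) * L := sq_sum_Icc_le M a
  -- (1) Σ a/√m ≤ S
  have h1 : ∑ m ∈ Icc 1 M, a m / Real.sqrt m ≤ S := by
    refine Finset.sum_le_sum fun m hm => ?_
    simp only [Finset.mem_Icc] at hm
    have hsq : 1 ≤ Real.sqrt m := by
      rw [show (1 : ℝ) = Real.sqrt 1 by simp]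
      exact Real.sqrt_le_sqrt (by exact_mod_cast hm.1)
    exact div_le_self (ha m) hsq
  have h1' : 0 ≤ ∑ m ∈ Icc 1 M, a m / Real.sqrt m :=
    Finset.sum_nonneg fun m _ => div_nonneg (ha m) (Real.sqrt_nonneg _)
  -- (2) Σ a√m ≤ √M · S ≤ M · S
  have h2 : ∑ m ∈ Icc 1 M, a m * Real.sqrt m ≤ (M : ℝ) * S := by
    have : ∑ m ∈ Icc 1 M, a m * Real.sqrt m ≤ ∑ m ∈ Icc 1 M, a m * M := by
      refine Finset.sum_le_sum fun m hm => ?_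
      simp only [Finset.mem_Icc] at hm
      refine mul_le_mul_of_nonneg_left ?_ (ha m)
      have hmM : (m : ℝ) ≤ M := by exact_mod_cast hm.2
      have hm0 : (0 : ℝ) ≤ m := by positivity
      calc Real.sqrt m ≤ Real.sqrt ((M : ℝ) ^ 2) :=
            Real.sqrt_le_sqrt (by nlinarith)
        _ = M := Real.sqrt_sq hMpos.le
    rw [← Finset.sum_mul] at this
    linarith
  have h2' : 0 ≤ ∑ m ∈ Icc 1 M, a m * Real.sqrt m :=
    Finset.sum_nonneg fun m _ => mul_nonneg (ha m) (Real.sqrt_nonneg _)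
  -- (3) log-Hilbert sum ≤ M · S²
  have h3 : ∑ m ∈ Icc 1 M, ∑ m' ∈ (Icc 1 M).erase m, a m * a m' / |Real.log m - Real.log m'| ≤
      (M : ℝ) * S ^ 2 := by
    have step : ∀ m ∈ Icc 1 M, ∑ m' ∈ (Icc 1 M).erase m, a m * a m' / |Real.log m - Real.log m'| ≤
        ∑ m' ∈ Icc 1 M, (M : ℝ) * (a m * a m') := by
      intro m hm
      calc ∑ m' ∈ (Icc 1 M).erase m, a m * a m' / |Real.log m - Real.log m'|
          ≤ ∑ m' ∈ (Icc 1 M).erase m, (M : ℝ) * (a m * a m') := by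
            refine Finset.sum_le_sum fun m' hm' => ?_
            have hne : m ≠ m' := fun h => (Finset.mem_erase.1 hm').1 h.symm
            have hm'' : m' ∈ Icc 1 M := Finset.mem_of_mem_erase hm'
            have hb := inv_abs_log_sub_log_le hm hm'' hne
            have hprod : 0 ≤ a m * a m' := mul_nonneg (ha m) (ha m')
            calc a m * a m' / |Real.log m - Real.log m'|
                = a m * a m' * (1 / |Real.log m - Real.log m'|) := by ring
              _ ≤ a m * a m' * M := mul_le_mul_of_nonneg_left hb hprod
              _ = (M : ℝ) * (a m * a m') := by ring
        _ ≤ ∑ m' ∈ Icc 1 M, (M : ℝ) * (a m * a m') :=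
            Finset.sum_le_sum_of_subset_of_nonneg (Finset.erase_subset _ _)
              fun m' _ _ => mul_nonneg hMpos.le (mul_nonneg (ha m) (ha m'))
    calc ∑ m ∈ Icc 1 M, ∑ m' ∈ (Icc 1 M).erase m, a m * a m' / |Real.log m - Real.log m'|
        ≤ ∑ m ∈ Icc 1 M, ∑ m' ∈ Icc 1 M, (M : ℝ) * (a m * a m') := Finset.sum_le_sum step
      _ = (M : ℝ) * S ^ 2 := by
          rw [hS, sq, Finset.sum_mul_sum]
          rw [Finset.mul_sum]
          refine Finset.sum_congr rfl fun m _ => ?_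
          rw [Finset.mul_sum]
  -- assemble
  have hA : 5 * (∑ m ∈ Icc 1 M, a m / Real.sqrt m) * (∑ m ∈ Icc 1 M, a m * Real.sqrt m) ≤
      5 * (M : ℝ) ^ 2 * L := by
    have : (∑ m ∈ Icc 1 M, a m / Real.sqrt m) * (∑ m ∈ Icc 1 M, a m * Real.sqrt m) ≤
        S * ((M : ℝ) * S) := mul_le_mul h1 h2 h2' hS0
    nlinarith
  have hB : 2 * (∑ m ∈ Icc 1 M, ∑ m' ∈ (Icc 1 M).erase m,
      a m * a m' / |Real.log m - Real.log m'|) ≤ 2 * (M : ℝ) ^ 2 * L := by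
    nlinarith
  have hC : 2 * S ^ 2 ≤ 2 * (M : ℝ) ^ 2 * L := by nlinarith
  nlinarith

/-- **S5 PROVED** (was `stub_shadowBudget`). -/
theorem shadowBudget_proof : Sig.stub_shadowBudget := by
  intro M y hM
  unfold archShadow l2
  exact shadow_le M (fun m => ‖((y m : ℝ) : ℂ)‖) (fun m => norm_nonneg _) hM

/-- **S6 PROVED** (was `stub_endgameComb`). With `ε = M^{-K}`, `K = max 4 (⌈(C+4)/log 2⌉₊ + 2)`, `A = K`, `c = (N/B)·log 2`. -/
theorem endgameComb_proof : Sig.stub_endgameComb := by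
  intro C N B hN hB
  have hlog2 : 0 < Real.log 2 := Real.log_pos (by norm_num)
  set K : ℕ := max 4 (⌈(C + 4) / Real.log 2⌉₊ + 2) with hKdef
  have hK4 : 4 ≤ K := le_max_left _ _
  have hKC : (C + 4) / Real.log 2 + 2 ≤ (K : ℝ) := by
    have h1 : (C + 4) / Real.log 2 ≤ (⌈(C + 4) / Real.log 2⌉₊ : ℝ) := Nat.le_ceil _
    have h2 : ((⌈(C + 4) / Real.log 2⌉₊ + 2 : ℕ) : ℝ) ≤ (K : ℝ) := by
      exact_mod_cast le_max_right 4 _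
    push_cast at h2
    linarith
  refine ⟨K, (K : ℝ), N / B * Real.log 2, by positivity, fun M hM => ?_⟩
  have hMr : (2 : ℝ) ≤ M := by exact_mod_cast hM
  have hMpos : (0 : ℝ) < M := by linarith
  have hMK : (0 : ℝ) < (M : ℝ) ^ K := by positivity
  -- powers: M^K = M^(K-2) · M², M^(K-2) ≥ 4, M^(K-1) ≥ 8
  have hsplit2 : (M : ℝ) ^ K = (M : ℝ) ^ (K - 2) * (M : ℝ) ^ 2 := by
    rw [← pow_add]; congr 1; omega
  have hsplit1 : (M : ℝ) ^ K = (M : ℝ) ^ (K - 1) * (M : ℝ) := by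
    rw [← pow_succ]; congr 1; omega
  have hpow2 : (4 : ℝ) ≤ (M : ℝ) ^ (K - 2) := by
    calc (4 : ℝ) = 2 ^ 2 := by norm_num
      _ ≤ (2 : ℝ) ^ (K - 2) := pow_le_pow_right₀ (by norm_num) (by omega)
      _ ≤ (M : ℝ) ^ (K - 2) := pow_le_pow_left₀ (by norm_num) hMr _
  have hpow1 : (8 : ℝ) ≤ (M : ℝ) ^ (K - 1) := by
    calc (8 : ℝ) = 2 ^ 3 := by norm_num
      _ ≤ (2 : ℝ) ^ (K - 1) := pow_le_pow_right₀ (by norm_num) (by omega)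
      _ ≤ (M : ℝ) ^ (K - 1) := pow_le_pow_left₀ (by norm_num) hMr _
  constructor
  · -- 8 ε M ≤ 1
    have e : 8 * ((M : ℝ) ^ K)⁻¹ * M = (8 * M) / (M : ℝ) ^ K := by ring
    rw [e, div_le_one hMK, hsplit1]
    exact mul_le_mul_of_nonneg_right hpow1 hMpos.le
  · -- main inequality
    have hlogM : Real.log 2 ≤ Real.log M := Real.log_le_log (by norm_num) hMr
    have hlogMpos : 0 < Real.log M := lt_of_lt_of_le hlog2 hlogM
    have hlog : Real.log (1 / ((M : ℝ) ^ K)⁻¹) = K * Real.log M := by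
      rw [one_div, inv_inv, Real.log_pow]
    have htail : ((M : ℝ) ^ K)⁻¹ * (12 * (M : ℝ) ^ 2) ≤ 3 := by
      have e : ((M : ℝ) ^ K)⁻¹ * (12 * (M : ℝ) ^ 2) = 12 * (M : ℝ) ^ 2 / (M : ℝ) ^ K := by ring
      rw [e, div_le_iff₀ hMK, hsplit2]
      have h4 : 4 * (M : ℝ) ^ 2 ≤ (M : ℝ) ^ (K - 2) * (M : ℝ) ^ 2 :=
        mul_le_mul_of_nonneg_right hpow2 (by positivity)
      linarith
    -- bracket ≥ log 2
    have hbr : Real.log 2 ≤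
        Real.log (1 / ((M : ℝ) ^ K)⁻¹) - C - (Real.log M + 1) - ((M : ℝ) ^ K)⁻¹ * (12 * (M : ℝ) ^ 2) := by
      rw [hlog]
      have hK1 : ((K : ℝ) - 1) * Real.log 2 ≤ ((K : ℝ) - 1) * Real.log M :=
        mul_le_mul_of_nonneg_left hlogM (by
          have : (4 : ℝ) ≤ K := by exact_mod_cast hK4
          linarith)
      have hKC' : C + 4 ≤ ((K : ℝ) - 2) * Real.log 2 := by
        have := (div_le_iff₀ hlog2).1 (by linarith : (C + 4) / Real.log 2 ≤ (K : ℝ) - 2)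
        linarith
      nlinarith
    -- rpow bookkeeping: M^(-K) = (M^K)⁻¹
    have hrpow : (M : ℝ) ^ (-(K : ℝ)) = ((M : ℝ) ^ K)⁻¹ := by
      rw [Real.rpow_neg hMpos.le, Real.rpow_natCast]
    rw [hrpow]
    have hcoef : 0 ≤ ((M : ℝ) ^ K)⁻¹ * N / B := by positivity
    calc N / B * Real.log 2 * ((M : ℝ) ^ K)⁻¹
        = ((M : ℝ) ^ K)⁻¹ * N / B * Real.log 2 := by ring
      _ ≤ ((M : ℝ) ^ K)⁻¹ * N / B *
          (Real.log (1 / ((M : ℝ) ^ K)⁻¹) - C - (Real.log M + 1) -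
            ((M : ℝ) ^ K)⁻¹ * (12 * (M : ℝ) ^ 2)) :=
          mul_le_mul_of_nonneg_left hbr hcoef


/-! ## S3: the comb is dominated by the screw form on the zero side -/

/-- The Dirichlet polynomial `P_y(s) = Σ_{m ≤ M} y_m e^{s log m}`. -/
def dirPoly (M : ℕ) (y : ℕ → ℝ) (s : ℂ) : ℂ :=
  ∑ m ∈ Icc 1 M, ((y m : ℝ) : ℂ) * cexp (s * (Real.log (m : ℝ) : ℂ))

/-! ## A. The comb is a Weil test; its transform -/

theorem tooth_eq (φ : ℝ → ℂ) (ε : ℝ) (y : ℕ → ℝ) (m : ℕ) :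
    (fun x : ℝ => ((y m : ℝ) : ℂ) * ((ε : ℂ)⁻¹ * φ ((x - Real.log (m : ℝ)) / ε))) =
      fun u : ℝ => (((y m : ℝ) : ℂ) * (ε : ℂ)⁻¹) * φ ((u - Real.log (m : ℝ)) * ε⁻¹) := by
  funext u
  rw [div_eq_mul_inv]
  ring

theorem isWeilTest_tooth' {φ : ℝ → ℂ} (hφ : IsWeilTest φ) {ε : ℝ} (hε : 0 < ε) (y : ℕ → ℝ)
    (m : ℕ) :
    IsWeilTest fun x : ℝ => ((y m : ℝ) : ℂ) * ((ε : ℂ)⁻¹ * φ ((x - Real.log (m : ℝ)) / ε)) := by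
  rw [tooth_eq]
  exact isWeilTest_tooth hφ _ _ (inv_ne_zero hε.ne')

theorem isWeilTest_comb {φ : ℝ → ℂ} (hφ : IsWeilTest φ) {ε : ℝ} (hε : 0 < ε) (M : ℕ)
    (y : ℕ → ℝ) : IsWeilTest (comb φ ε M y) :=
  isWeilTest_finset_sum (Icc 1 M) fun m _ => isWeilTest_tooth' hφ hε y m

theorem weilMellin_tooth' (φ : ℝ → ℂ) {ε : ℝ} (hε : 0 < ε) (y : ℕ → ℝ) (m : ℕ) (s : ℂ) :
    weilMellin (fun x : ℝ => ((y m : ℝ) : ℂ) * ((ε : ℂ)⁻¹ * φ ((x - Real.log (m : ℝ)) / ε))) s =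
      weilMellin φ (1 / 2 + (s - 1 / 2) * ε) *
        (((y m : ℝ) : ℂ) * cexp ((s - 1 / 2) * (Real.log (m : ℝ) : ℂ))) := by
  rw [tooth_eq, weilMellin_tooth φ _ _ (inv_pos.2 hε) s]
  have hε' : (ε : ℂ) ≠ 0 := by exact_mod_cast hε.ne'
  have e1 : ((ε⁻¹ : ℝ) : ℂ) = (ε : ℂ)⁻¹ := Complex.ofReal_inv ε
  rw [e1, inv_inv]
  have e2 : 1 / 2 + (s - 1 / 2) / (ε : ℂ)⁻¹ = 1 / 2 + (s - 1 / 2) * ε := by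
    rw [div_inv_eq_mul]
  rw [e2]
  field_simp

theorem weilMellin_comb {φ : ℝ → ℂ} (hφ : IsWeilTest φ) {ε : ℝ} (hε : 0 < ε) (M : ℕ)
    (y : ℕ → ℝ) (s : ℂ) :
    weilMellin (comb φ ε M y) s =
      weilMellin φ (1 / 2 + (s - 1 / 2) * ε) * dirPoly M y (s - 1 / 2) := by
  unfold comb dirPoly
  rw [weilMellin_finset_sum (Icc 1 M) (fun m _ => isWeilTest_tooth' hφ hε y m) s, Finset.mul_sum]
  refine Finset.sum_congr rfl fun m _ => ?_
  rw [weilMellin_tooth' φ hε y m s]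

/-! ## B. The screw form as a sum over the zeros (unconditional algebra) -/

/-- Core finite identity: with `C = Σ_{2≤a≤M} y_a cosh(s log a)`, `S = Σ y_a sinh(s log a)`,
`c = Σ_{2≤a≤M} y_a`:
`Σ_{a,b} y_a y_b [cosh(sA) + cosh(sB) − cosh(sA − sB) − 1] = 2cC − (C² − S²) − c²`. -/
theorem kernel_double_sum (M : ℕ) (y : ℕ → ℝ) (s : ℂ) :
    ∑ a ∈ Icc 2 M, ∑ b ∈ Icc 2 M, ((y a : ℝ) : ℂ) * ((y b : ℝ) : ℂ) *
        (Complex.cosh (s * (Real.log (a : ℝ) : ℂ)) + Complex.cosh (s * (Real.log (b : ℝ) : ℂ)) -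
          Complex.cosh (s * (Real.log (a : ℝ) : ℂ) - s * (Real.log (b : ℝ) : ℂ)) - 1) =
      2 * (∑ a ∈ Icc 2 M, ((y a : ℝ) : ℂ)) *
          (∑ a ∈ Icc 2 M, ((y a : ℝ) : ℂ) * Complex.cosh (s * (Real.log (a : ℝ) : ℂ))) -
        ((∑ a ∈ Icc 2 M, ((y a : ℝ) : ℂ) * Complex.cosh (s * (Real.log (a : ℝ) : ℂ))) ^ 2 -
          (∑ a ∈ Icc 2 M, ((y a : ℝ) : ℂ) * Complex.sinh (s * (Real.log (a : ℝ) : ℂ))) ^ 2) -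
        (∑ a ∈ Icc 2 M, ((y a : ℝ) : ℂ)) ^ 2 := by
  have hsummand : ∀ a b : ℕ,
      ((y a : ℝ) : ℂ) * ((y b : ℝ) : ℂ) *
          (Complex.cosh (s * (Real.log (a : ℝ) : ℂ)) + Complex.cosh (s * (Real.log (b : ℝ) : ℂ)) -
            Complex.cosh (s * (Real.log (a : ℝ) : ℂ) - s * (Real.log (b : ℝ) : ℂ)) - 1) =
        (((y a : ℝ) : ℂ) * Complex.cosh (s * (Real.log (a : ℝ) : ℂ))) * ((y b : ℝ) : ℂ) +
          ((y a : ℝ) : ℂ) * (((y b : ℝ) : ℂ) * Complex.cosh (s * (Real.log (b : ℝ) : ℂ))) -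
          (((y a : ℝ) : ℂ) * Complex.cosh (s * (Real.log (a : ℝ) : ℂ))) *
            (((y b : ℝ) : ℂ) * Complex.cosh (s * (Real.log (b : ℝ) : ℂ))) +
          (((y a : ℝ) : ℂ) * Complex.sinh (s * (Real.log (a : ℝ) : ℂ))) *
            (((y b : ℝ) : ℂ) * Complex.sinh (s * (Real.log (b : ℝ) : ℂ))) -
          ((y a : ℝ) : ℂ) * ((y b : ℝ) : ℂ) := by
    intro a b
    rw [Complex.cosh_sub]
    ring
  rw [Finset.sum_congr rfl fun a _ => Finset.sum_congr rfl fun b _ => hsummand a b]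
  simp only [Finset.sum_add_distrib, Finset.sum_sub_distrib]
  rw [← Finset.sum_mul_sum, ← Finset.sum_mul_sum, ← Finset.sum_mul_sum, ← Finset.sum_mul_sum,
    ← Finset.sum_mul_sum]
  ring

/-- The Dirichlet polynomial split at `m = 1`: `P(s) = y_1 + C + S`, `P(-s) = y_1 + C − S`. -/
theorem dirPoly_eq (M : ℕ) (hM : 1 ≤ M) (y : ℕ → ℝ) (s : ℂ) :
    dirPoly M y s = ((y 1 : ℝ) : ℂ) +
      ((∑ a ∈ Icc 2 M, ((y a : ℝ) : ℂ) * Complex.cosh (s * (Real.log (a : ℝ) : ℂ))) +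
        ∑ a ∈ Icc 2 M, ((y a : ℝ) : ℂ) * Complex.sinh (s * (Real.log (a : ℝ) : ℂ))) := by
  unfold dirPoly
  have hsplit : Finset.Icc 1 M = insert 1 (Finset.Icc 2 M) := by
    ext k; simp only [Finset.mem_Icc, Finset.mem_insert]; omega
  have h1notin : (1 : ℕ) ∉ Finset.Icc 2 M := by simp
  rw [hsplit, Finset.sum_insert h1notin, ← Finset.sum_add_distrib]
  congr 1
  · simp
  · refine Finset.sum_congr rfl fun a _ => ?_
    rw [← mul_add, Complex.cosh_add_sinh]

theorem dirPoly_neg_eq (M : ℕ) (hM : 1 ≤ M) (y : ℕ → ℝ) (s : ℂ) :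
    dirPoly M y (-s) = ((y 1 : ℝ) : ℂ) +
      ((∑ a ∈ Icc 2 M, ((y a : ℝ) : ℂ) * Complex.cosh (s * (Real.log (a : ℝ) : ℂ))) -
        ∑ a ∈ Icc 2 M, ((y a : ℝ) : ℂ) * Complex.sinh (s * (Real.log (a : ℝ) : ℂ))) := by
  unfold dirPoly
  have hsplit : Finset.Icc 1 M = insert 1 (Finset.Icc 2 M) := by
    ext k; simp only [Finset.mem_Icc, Finset.mem_insert]; omega
  have h1notin : (1 : ℕ) ∉ Finset.Icc 2 M := by simp
  rw [hsplit, Finset.sum_insert h1notin, ← Finset.sum_sub_distrib]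
  congr 1
  · simp
  · refine Finset.sum_congr rfl fun a _ => ?_
    rw [← mul_sub, Complex.cosh_sub_sinh, neg_mul]

/-- The per-zero identity: for `Σ_{m ≤ M} y_m = 0` and any `s`,
`Σ_{a,b ≥ 2} y_a y_b [cosh(sA) + cosh(sB) − cosh(s(A−B)) − 1] = −P(s)·P(−s)`. -/
theorem kernel_double_sum_eq_neg_dirPoly (M : ℕ) (hM : 1 ≤ M) (y : ℕ → ℝ)
    (hy0 : ∑ m ∈ Icc 1 M, y m = 0) (s : ℂ) :
    ∑ a ∈ Icc 2 M, ∑ b ∈ Icc 2 M, ((y a : ℝ) : ℂ) * ((y b : ℝ) : ℂ) *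
        (Complex.cosh (s * (Real.log (a : ℝ) : ℂ)) + Complex.cosh (s * (Real.log (b : ℝ) : ℂ)) -
          Complex.cosh (s * (Real.log (a : ℝ) : ℂ) - s * (Real.log (b : ℝ) : ℂ)) - 1) =
      -(dirPoly M y s * dirPoly M y (-s)) := by
  rw [kernel_double_sum, dirPoly_eq M hM y s, dirPoly_neg_eq M hM y s]
  have hsplit : Finset.Icc 1 M = insert 1 (Finset.Icc 2 M) := by
    ext k; simp only [Finset.mem_Icc, Finset.mem_insert]; omega
  have h1notin : (1 : ℕ) ∉ Finset.Icc 2 M := by simp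
  have hy1 : ((y 1 : ℝ) : ℂ) = -∑ a ∈ Icc 2 M, ((y a : ℝ) : ℂ) := by
    have : y 1 + ∑ a ∈ Icc 2 M, y a = 0 := by
      rw [hsplit, Finset.sum_insert h1notin] at hy0
      exact hy0
    have : y 1 = -∑ a ∈ Icc 2 M, y a := by linarith
    rw [this]
    push_cast
    rfl
  rw [hy1]
  ring


/-! ## B2. `HasSum` over the non-trivial zeros for the screw form (unconditional) -/

/-- Suzuki's summand at `t`. -/
def suzTerm (t : ℝ) (ρ : ZetaZeros.riemannZetaNontrivialZeros) : ℂ :=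
  (riemannZetaZeroOrder (ρ : ℂ) : ℂ) *
    ((Complex.cosh (((ρ : ℂ) - 1 / 2) * t) - 1) / ((ρ : ℂ) - 1 / 2) ^ 2)

theorem hasSum_suzTerm (t : ℝ) : HasSum (suzTerm t) (zetaScrew t : ℂ) := by
  have h : Suzuki2023_thm11_series := Suzuki2023_thm11_series_holds
  exact h t

/-- The kernel entry as a sum over zeros. -/
theorem hasSum_kernel (u v : ℝ) :
    HasSum (fun ρ => suzTerm u ρ + suzTerm v ρ - suzTerm (u - v) ρ)
      (zetaScrewKernel u v : ℂ) := by
  have h := ((hasSum_suzTerm u).add (hasSum_suzTerm v)).sub (hasSum_suzTerm (u - v))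
  rw [zetaScrewKernel_def]
  push_cast
  exact h

/-- The screw form as a sum over zeros of the raw kernel combination. -/
theorem hasSum_screwForm_raw (M : ℕ) (y : ℕ → ℝ) :
    HasSum (fun ρ => ∑ a ∈ Icc 2 M, ∑ b ∈ Icc 2 M,
        (((y a : ℝ) : ℂ) * ((y b : ℝ) : ℂ)) *
          (suzTerm (Real.log a) ρ + suzTerm (Real.log b) ρ - suzTerm (Real.log a - Real.log b) ρ))
      (screwForm M y : ℂ) := by
  unfold screwForm
  push_cast
  refine hasSum_sum fun a _ => hasSum_sum fun b _ => ?_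
  have h := (hasSum_kernel (Real.log a) (Real.log b)).mul_left (((y a : ℝ) : ℂ) * ((y b : ℝ) : ℂ))
  have e : (zetaScrewKernel (Real.log a) (Real.log b) : ℂ) * ((y a : ℂ) * (y b : ℂ)) =
      ((y a : ℝ) : ℂ) * ((y b : ℝ) : ℂ) * (zetaScrewKernel (Real.log a) (Real.log b) : ℂ) := by ring
  rw [e]
  exact h

/-- Per-zero rewriting of the raw summand. -/
theorem raw_summand_eq (M : ℕ) (hM : 1 ≤ M) (y : ℕ → ℝ) (hy0 : ∑ m ∈ Icc 1 M, y m = 0)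
    (ρ : ZetaZeros.riemannZetaNontrivialZeros) :
    ∑ a ∈ Icc 2 M, ∑ b ∈ Icc 2 M,
        (((y a : ℝ) : ℂ) * ((y b : ℝ) : ℂ)) *
          (suzTerm (Real.log a) ρ + suzTerm (Real.log b) ρ - suzTerm (Real.log a - Real.log b) ρ) =
      (riemannZetaZeroOrder (ρ : ℂ) : ℂ) *
        (-(dirPoly M y ((ρ : ℂ) - 1 / 2) * dirPoly M y (-((ρ : ℂ) - 1 / 2))) /
          ((ρ : ℂ) - 1 / 2) ^ 2) := by
  set s : ℂ := (ρ : ℂ) - 1 / 2 with hs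
  set μ : ℂ := (riemannZetaZeroOrder (ρ : ℂ) : ℂ) with hμ
  have hterm : ∀ a b : ℕ,
      (((y a : ℝ) : ℂ) * ((y b : ℝ) : ℂ)) *
          (suzTerm (Real.log a) ρ + suzTerm (Real.log b) ρ - suzTerm (Real.log a - Real.log b) ρ) =
        μ / s ^ 2 * (((y a : ℝ) : ℂ) * ((y b : ℝ) : ℂ) *
          (Complex.cosh (s * (Real.log (a : ℝ) : ℂ)) + Complex.cosh (s * (Real.log (b : ℝ) : ℂ)) -
            Complex.cosh (s * (Real.log (a : ℝ) : ℂ) - s * (Real.log (b : ℝ) : ℂ)) - 1)) := by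
    intro a b
    simp only [suzTerm, ← hs, ← hμ]
    push_cast
    rw [mul_sub s]
    ring
  rw [Finset.sum_congr rfl fun a _ => Finset.sum_congr rfl fun b _ => hterm a b]
  simp_rw [← Finset.mul_sum]
  rw [kernel_double_sum_eq_neg_dirPoly M hM y hy0 s]
  ring

/-- **Unconditional zero expansion of the screw form.** -/
theorem hasSum_screwForm (M : ℕ) (hM : 1 ≤ M) (y : ℕ → ℝ) (hy0 : ∑ m ∈ Icc 1 M, y m = 0) :
    HasSum (fun ρ : ZetaZeros.riemannZetaNontrivialZeros =>
      (riemannZetaZeroOrder (ρ : ℂ) : ℂ) *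
        (-(dirPoly M y ((ρ : ℂ) - 1 / 2) * dirPoly M y (-((ρ : ℂ) - 1 / 2))) /
          ((ρ : ℂ) - 1 / 2) ^ 2)) (screwForm M y : ℂ) := by
  have h := hasSum_screwForm_raw M y
  have e := funext (raw_summand_eq M hM y hy0)
  rw [e] at h
  exact h

/-! ## C. Under RH: real, non-negative terms -/

theorem re_eq_half_of_mem (hRH : RiemannHypothesis) {ρ : ℂ}
    (hρ : ρ ∈ ZetaZeros.riemannZetaNontrivialZeros) : ρ.re = 1 / 2 := by
  have hζ : riemannZeta ρ = 0 := hρ.1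
  have htriv : ¬∃ n : ℕ, ρ = -2 * (n + 1) := by
    rintro ⟨n, hn⟩
    exact hρ.2 ⟨n, hn.symm⟩
  have hne : ρ ≠ 1 := by
    rintro rfl
    exact riemannZeta_one_ne_zero hζ
  exact hRH ρ hζ htriv hne

theorem ne_one_of_mem {ρ : ℂ} (hρ : ρ ∈ ZetaZeros.riemannZetaNontrivialZeros) : ρ ≠ 1 := by
  rintro rfl
  exact riemannZeta_one_ne_zero hρ.1

theorem dirPoly_conj (M : ℕ) (y : ℕ → ℝ) (s : ℂ) :
    conj (dirPoly M y s) = dirPoly M y (conj s) := by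
  unfold dirPoly
  rw [map_sum]
  refine Finset.sum_congr rfl fun m _ => ?_
  rw [map_mul, Complex.conj_ofReal, ← Complex.exp_conj, map_mul, Complex.conj_ofReal]

/-- The real weight of a zero under RH. -/
def zeroWeight (M : ℕ) (y : ℕ → ℝ) (ρ : ℂ) : ℝ :=
  (riemannZetaZeroOrder ρ : ℝ) * (Complex.normSq (dirPoly M y (ρ - 1 / 2)) / ρ.im ^ 2)

theorem zeroWeight_nonneg (M : ℕ) (y : ℕ → ℝ) {ρ : ℂ} (hρ : ρ ≠ 1) : 0 ≤ zeroWeight M y ρ :=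
  mul_nonneg (by exact_mod_cast riemannZetaZeroOrder_nonneg hρ)
    (div_nonneg (Complex.normSq_nonneg _) (sq_nonneg _))

theorem term_eq_zeroWeight (hRH : RiemannHypothesis) (M : ℕ) (y : ℕ → ℝ) {ρ : ℂ}
    (hρ : ρ ∈ ZetaZeros.riemannZetaNontrivialZeros) :
    (riemannZetaZeroOrder ρ : ℂ) *
        (-(dirPoly M y (ρ - 1 / 2) * dirPoly M y (-(ρ - 1 / 2))) / (ρ - 1 / 2) ^ 2) =
      ((zeroWeight M y ρ : ℝ) : ℂ) := by
  have hre := re_eq_half_of_mem hRH hρ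
  have hs : ρ - 1 / 2 = (ρ.im : ℂ) * I := by
    apply Complex.ext
    · simp [hre]
    · simp
  have hconj : -(ρ - 1 / 2) = conj (ρ - 1 / 2) := by
    rw [hs, map_mul, Complex.conj_ofReal, Complex.conj_I]
    ring
  have hP : dirPoly M y (-(ρ - 1 / 2)) = conj (dirPoly M y (ρ - 1 / 2)) := by
    rw [hconj, dirPoly_conj]
  have hsq : (ρ - 1 / 2) ^ 2 = -((ρ.im : ℂ) ^ 2) := by
    rw [hs, mul_pow, Complex.I_sq]
    ring
  rw [hP, Complex.mul_conj, hsq, neg_div_neg_eq]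
  unfold zeroWeight
  push_cast
  ring

theorem hasSum_zeroWeight (hRH : RiemannHypothesis) (M : ℕ) (hM : 1 ≤ M) (y : ℕ → ℝ)
    (hy0 : ∑ m ∈ Icc 1 M, y m = 0) :
    HasSum (fun ρ : ZetaZeros.riemannZetaNontrivialZeros => zeroWeight M y (ρ : ℂ))
      (screwForm M y) := by
  have h := hasSum_screwForm M hM y hy0
  have e : (fun ρ : ZetaZeros.riemannZetaNontrivialZeros =>
      (riemannZetaZeroOrder (ρ : ℂ) : ℂ) *
        (-(dirPoly M y ((ρ : ℂ) - 1 / 2) * dirPoly M y (-((ρ : ℂ) - 1 / 2))) /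
          ((ρ : ℂ) - 1 / 2) ^ 2)) =
      fun ρ : ZetaZeros.riemannZetaNontrivialZeros => ((zeroWeight M y (ρ : ℂ) : ℝ) : ℂ) := by
    funext ρ
    exact term_eq_zeroWeight hRH M y ρ.2
  rw [e] at h
  exact Complex.hasSum_ofReal.1 h

theorem sum_zeroWeight_le (hRH : RiemannHypothesis) (M : ℕ) (hM : 1 ≤ M) (y : ℕ → ℝ)
    (hy0 : ∑ m ∈ Icc 1 M, y m = 0) (F : Finset ZetaZeros.riemannZetaNontrivialZeros) :
    ∑ ρ ∈ F, zeroWeight M y (ρ : ℂ) ≤ screwForm M y :=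
  sum_le_hasSum F (fun ρ _ => zeroWeight_nonneg M y (ne_one_of_mem ρ.2))
    (hasSum_zeroWeight hRH M hM y hy0)

/-! ## D. The comb's zero side, term by term -/

theorem mem_nontrivial_of_mem_weilZeroIndex {T : ℝ} {ρ : ℂ} (h : ρ ∈ weilZeroIndex T) :
    ρ ∈ ZetaZeros.riemannZetaNontrivialZeros := by
  obtain ⟨hζ, -, -, him, -⟩ := h
  refine ⟨hζ, ?_⟩
  rintro ⟨n, hn⟩
  apply him
  rw [← hn]
  simp

/-- Termwise domination at a zero `ρ` with `Re ρ = 1/2`, `Im ρ ≠ 0`. -/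
theorem term_re_le {φ : ℝ → ℂ} (hφ : IsWeilTest φ) {ε : ℝ} (hε : 0 < ε) (M : ℕ) (y : ℕ → ℝ)
    {ρ : ℂ} (hre : ρ.re = 1 / 2) (him : ρ.im ≠ 0) :
    ((riemannZetaZeroOrder ρ : ℂ) *
        weilMellin (weilConv (comb φ ε M y) (weilReflect (comb φ ε M y))) ρ).re ≤
      weilL1 (deriv φ) ^ 2 * ε⁻¹ ^ 2 * zeroWeight M y ρ := by
  have hg : IsWeilTest (comb φ ε M y) := isWeilTest_comb hφ hε M y
  have hne1 : ρ ≠ 1 := by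
    rintro rfl
    simp at him
  rw [weilMellin_weilQuadratic_of_re_eq hg hre, ← Complex.ofReal_intCast, ← Complex.ofReal_mul,
    Complex.ofReal_re, weilMellin_comb hφ hε M y ρ, Complex.normSq_mul]
  -- the bump factor
  set w : ℂ := 1 / 2 + (ρ - 1 / 2) * ε with hw
  have hwre : w.re = 1 / 2 := by
    rw [hw]
    simp [hre]
  have hwim : w.im = ρ.im * ε := by
    rw [hw]
    simp [hre]
  have hw0 : 0 ≤ w.re := by rw [hwre]; norm_num
  have hw1 : w.re ≤ 1 := by rw [hwre]; norm_num
  have hwne : w.im ≠ 0 := by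
    rw [hwim]
    exact mul_ne_zero him hε.ne'
  have hdec := norm_weilMellin_le_weilL1_iterate_deriv_div hφ 1 hw0 hw1 hwne
  simp only [Function.iterate_one, pow_one] at hdec
  have hL0 : 0 ≤ weilL1 (deriv φ) := weilL1_nonneg _
  have hsq : Complex.normSq (weilMellin φ w) ≤ (weilL1 (deriv φ) / |w.im|) ^ 2 := by
    rw [Complex.normSq_eq_norm_sq]
    exact pow_le_pow_left₀ (norm_nonneg _) hdec 2
  have hm0 : (0 : ℝ) ≤ riemannZetaZeroOrder ρ := by exact_mod_cast riemannZetaZeroOrder_nonneg hne1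
  have hP0 : 0 ≤ Complex.normSq (dirPoly M y (ρ - 1 / 2)) := Complex.normSq_nonneg _
  calc (riemannZetaZeroOrder ρ : ℝ) *
        (Complex.normSq (weilMellin φ w) * Complex.normSq (dirPoly M y (ρ - 1 / 2)))
      ≤ (riemannZetaZeroOrder ρ : ℝ) *
          ((weilL1 (deriv φ) / |w.im|) ^ 2 * Complex.normSq (dirPoly M y (ρ - 1 / 2))) :=
        mul_le_mul_of_nonneg_left (mul_le_mul_of_nonneg_right hsq hP0) hm0
    _ = weilL1 (deriv φ) ^ 2 * ε⁻¹ ^ 2 * zeroWeight M y ρ := by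
        unfold zeroWeight
        rw [hwim, div_pow, sq_abs]
        field_simp

/-- Every truncated zero side of the comb is dominated by the screw form (under RH). -/
theorem weilZeroSidePartial_re_le (hRH : RiemannHypothesis) {φ : ℝ → ℂ} (hφ : IsWeilTest φ)
    {ε : ℝ} (hε : 0 < ε) (M : ℕ) (hM : 1 ≤ M) (y : ℕ → ℝ) (hy0 : ∑ m ∈ Icc 1 M, y m = 0)
    (T : ℝ) :
    (weilZeroSidePartial (weilConv (comb φ ε M y) (weilReflect (comb φ ε M y))) T).re ≤
      weilL1 (deriv φ) ^ 2 * ε⁻¹ ^ 2 * screwForm M y := by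
  classical
  unfold weilZeroSidePartial
  rw [finsum_mem_eq_finite_toFinset_sum _ (weilZeroIndex_finite T), Complex.re_sum]
  set F := (weilZeroIndex_finite T).toFinset with hF
  have hmem : ∀ ρ ∈ F, ρ ∈ weilZeroIndex T := fun ρ h => (Set.Finite.mem_toFinset _).1 h
  have hB : 0 ≤ weilL1 (deriv φ) ^ 2 * ε⁻¹ ^ 2 := by positivity
  calc ∑ ρ ∈ F, ((riemannZetaZeroOrder ρ : ℂ) *
          weilMellin (weilConv (comb φ ε M y) (weilReflect (comb φ ε M y))) ρ).re
      ≤ ∑ ρ ∈ F, weilL1 (deriv φ) ^ 2 * ε⁻¹ ^ 2 * zeroWeight M y ρ := by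
        refine Finset.sum_le_sum fun ρ hρ => ?_
        obtain ⟨hζ, -, -, him, -⟩ := hmem ρ hρ
        have hre := re_eq_half_of_mem hRH (mem_nontrivial_of_mem_weilZeroIndex (hmem ρ hρ))
        exact term_re_le hφ hε M y hre him
    _ = weilL1 (deriv φ) ^ 2 * ε⁻¹ ^ 2 * ∑ ρ ∈ F, zeroWeight M y ρ := by
        rw [Finset.mul_sum]
    _ = weilL1 (deriv φ) ^ 2 * ε⁻¹ ^ 2 *
          ∑ ρ ∈ F.subtype (· ∈ ZetaZeros.riemannZetaNontrivialZeros), zeroWeight M y (ρ : ℂ) := by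
        rw [Finset.sum_subtype_of_mem (fun ρ => zeroWeight M y ρ)
          (fun ρ hρ => mem_nontrivial_of_mem_weilZeroIndex (hmem ρ hρ))]
    _ ≤ weilL1 (deriv φ) ^ 2 * ε⁻¹ ^ 2 * screwForm M y :=
        mul_le_mul_of_nonneg_left (sum_zeroWeight_le hRH M hM y hy0 _) hB

/-- **S3 PROVED**: under RH, `Re Q(comb) ≤ ‖φ'‖₁'² ε⁻² · screwForm`. -/
theorem combDominated (hRH : RiemannHypothesis) {φ : ℝ → ℂ} (hφ : IsWeilTest φ) (M : ℕ)
    (ε : ℝ) (y : ℕ → ℝ) (hM : 1 ≤ M) (hε : 0 < ε) (hy0 : ∑ m ∈ Icc 1 M, y m = 0) :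
    (weilQuadratic (comb φ ε M y)).re ≤ weilL1 (deriv φ) ^ 2 * ε⁻¹ ^ 2 * screwForm M y := by
  have hg : IsWeilTest (comb φ ε M y) := isWeilTest_comb hφ hε M y
  have hk : IsWeilTest (weilConv (comb φ ε M y) (weilReflect (comb φ ε M y))) :=
    hg.weilConv hg.weilReflect
  have hEF : explicit_formula := explicit_formula_holds
  have hlim : Tendsto
      (fun T => (weilZeroSidePartial (weilConv (comb φ ε M y) (weilReflect (comb φ ε M y))) T).re)
      atTop (𝓝 (weilQuadratic (comb φ ε M y)).re) :=
    (Complex.continuous_re.tendsto _).comp (hEF hk)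
  exact le_of_tendsto' hlim fun T => weilZeroSidePartial_re_le hRH hφ hε M hM y hy0 T


/-- **S3** in the registered stub shape (`Sig.stub_combDominated`). -/
theorem combDominated_proof : Sig.stub_combDominated :=
  fun hRH _ hφ M ε y hM hε hy0 => combDominated hRH hφ M ε y hM hε hy0

/-! ## Composition -/

/-- The Helson bound (route WeilComb's `combHelsonBound_proof`, PROVED) on real vectors. -/
theorem helson_le (M : ℕ) (y : ℕ → ℝ) (hM : 1 ≤ M) :
    helson M y ≤ (Real.log M + 1) * l2 M y := by
  have h := Summit.RiemannHypothesis.RiemannHypothesis.Theorems.combHelsonBound_proof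
  unfold Summit.RiemannHypothesis.RiemannHypothesis.Theses.WeilComb.CombHelsonBound at h
  have h2 := h M (fun m => ((y m : ℝ) : ℂ)) hM
  unfold helson l2
  exact h2

/-- `l2 M y = Σ_{m ≤ M} y_m²` dominates the crux's `Σ_{2 ≤ m ≤ M} y_m²`. -/
theorem sum_Icc_two_sq_le_l2 (M : ℕ) (y : ℕ → ℝ) :
    ∑ m ∈ Icc 2 M, y m ^ 2 ≤ l2 M y := by
  unfold l2
  have hsub : Icc 2 M ⊆ Icc 1 M := by
    intro k hk
    simp only [Finset.mem_Icc] at hk ⊢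
    omega
  have e : ∀ m, ‖((y m : ℝ) : ℂ)‖ ^ 2 = y m ^ 2 := fun m => by
    rw [Complex.norm_real, Real.norm_eq_abs, sq_abs]
  simp_rw [e]
  exact Finset.sum_le_sum_of_subset_of_nonneg hsub fun m _ _ => sq_nonneg _

/-- The floor law under RH — the route item `FloorOfRH` (stmt-RiemannHypothesis-15762) BY NAME —
from stubs S3–S6, WeilComb's PROVED `analyticReduction` and `combHelsonBound_proof`
(sorry-free composition; no RH-strength stub enters). -/
theorem FloorOfRH_of (h3 : Sig.stub_combDominated) (h4 : Sig.stub_bumpWitness)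
    (h5 : Sig.stub_shadowBudget) (h6 : Sig.stub_endgameComb) :
    Summit.RiemannHypothesis.RiemannHypothesis.Theses.IntegerScrew.FloorOfRH := by
  intro hRH
  obtain ⟨φ, hφ, hsupp, hN, hB⟩ := h4
  obtain ⟨C, hC⟩ :=
    Summit.RiemannHypothesis.RiemannHypothesis.Theorems.WeilCombSubcritical.analyticReduction
  obtain ⟨K, A, c, hc, hK⟩ := h6 C (weilNorm2Sq φ) (weilL1 (deriv φ) ^ 2) hN (by positivity)
  refine ⟨A, c, hc, fun M x => ?_⟩
  rcases lt_or_ge M 2 with hM | hM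
  · have hE : Finset.Icc 2 M = ∅ := Finset.Icc_eq_empty (by omega)
    simp [hE]
  · classical
    obtain ⟨h8, hmain⟩ := hK M hM
    have hM1 : 1 ≤ M := by omega
    have hMpos : (0 : ℝ) < (M : ℝ) := by exact_mod_cast (show 0 < M by omega)
    -- the parameter
    set ε : ℝ := ((M : ℝ) ^ K)⁻¹ with hεdef
    have hε : 0 < ε := by rw [hεdef]; positivity
    -- the test vector with vanishing sum
    set y : ℕ → ℝ := fun m => if m = 1 then -∑ k ∈ Finset.Icc 2 M, x k else x m with hydef
    have hsplit : Finset.Icc 1 M = insert 1 (Finset.Icc 2 M) := by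
      ext k
      simp only [Finset.mem_Icc, Finset.mem_insert]
      omega
    have h1notin : (1 : ℕ) ∉ Finset.Icc 2 M := by simp
    have hyx : ∀ k ∈ Finset.Icc 2 M, y k = x k := by
      intro k hk
      have hk1 : k ≠ 1 := by
        simp only [Finset.mem_Icc] at hk
        omega
      simp [hydef, hk1]
    have hy1 : y 1 = -∑ k ∈ Finset.Icc 2 M, x k := by simp [hydef]
    have hsum0 : ∑ m ∈ Finset.Icc 1 M, y m = 0 := by
      rw [hsplit, Finset.sum_insert h1notin, Finset.sum_congr rfl hyx, hy1]
      ring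
    -- the four analytic inputs
    have h8' : 8 * ε * M ≤ 1 := by rw [hεdef]; exact h8
    have hR := hC φ hφ hsupp ε hε M (fun m => ((y m : ℝ) : ℂ)) hM1 h8'
    have hD := h3 hRH φ hφ M ε y hM1 hε hsum0
    have hHel := helson_le M y hM1
    have hSh := h5 M y hM1
    -- names for the atoms
    set N : ℝ := weilNorm2Sq φ with hNdef
    set B : ℝ := weilL1 (deriv φ) ^ 2 with hBdef
    set L : ℝ := l2 M y with hLdef
    have hL0 : 0 ≤ L := Finset.sum_nonneg fun m _ => sq_nonneg _
    have hεN : 0 ≤ ε⁻¹ * N := mul_nonneg (inv_nonneg.2 hε.le) hN.le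
    -- monotonicity inside the bracket of the analytic reduction
    have hmono : ε⁻¹ * N *
        (L * (Real.log (1 / ε) - C - (Real.log M + 1) - ε * (12 * (M : ℝ) ^ 2))) ≤
        ε⁻¹ * N * ((Real.log (1 / ε) - C) * L - helson M y - ε * archShadow M y) := by
      apply mul_le_mul_of_nonneg_left _ hεN
      have a1 : helson M y ≤ (Real.log M + 1) * L := hHel
      have a2 : ε * archShadow M y ≤ ε * (12 * (M : ℝ) ^ 2 * L) :=
        mul_le_mul_of_nonneg_left hSh hε.le
      have e1 : L * (Real.log (1 / ε) - C - (Real.log M + 1) - ε * (12 * (M : ℝ) ^ 2)) =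
          (Real.log (1 / ε) - C) * L - (Real.log M + 1) * L - ε * (12 * (M : ℝ) ^ 2 * L) := by
        ring
      rw [e1]
      linarith
    -- the analytic reduction, read on the comb with coefficients `y`
    have hR' : ε⁻¹ * N * ((Real.log (1 / ε) - C) * L - helson M y - ε * archShadow M y) ≤
        (weilQuadratic (comb φ ε M y)).re := hR
    -- domination of the comb form by the screw form
    have hD' : (weilQuadratic (comb φ ε M y)).re ≤ B * ε⁻¹ ^ 2 * screwForm M y := by
      simpa only [hBdef] using hD
    have key : ε⁻¹ * N *
        (L * (Real.log (1 / ε) - C - (Real.log M + 1) - ε * (12 * (M : ℝ) ^ 2))) ≤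
        B * ε⁻¹ ^ 2 * screwForm M y :=
      le_trans (le_trans hmono hR') hD'
    -- the screw form in the `x` variables
    have hQ : screwForm M y =
        ∑ m ∈ Icc 2 M, ∑ m' ∈ Icc 2 M,
          zetaScrewKernel (Real.log m) (Real.log m') * (x m * x m') := by
      unfold screwForm
      exact Finset.sum_congr rfl fun m hm => Finset.sum_congr rfl fun m' hm' => by
        rw [hyx m hm, hyx m' hm']
    have hsqy : ∑ k ∈ Icc 2 M, x k ^ 2 = ∑ k ∈ Icc 2 M, y k ^ 2 :=
      Finset.sum_congr rfl fun k hk => by rw [hyx k hk]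
    have hsq : ∑ m ∈ Icc 2 M, x m ^ 2 ≤ L := by
      rw [hsqy, hLdef]
      exact sum_Icc_two_sq_le_l2 M y
    have hcA : 0 ≤ c * (M : ℝ) ^ (-A) :=
      mul_nonneg hc.le (Real.rpow_nonneg (Nat.cast_nonneg M) _)
    have hBε : 0 < B * ε⁻¹ ^ 2 := by positivity
    have hεne : ε ≠ 0 := hε.ne'
    have hBne : B ≠ 0 := by positivity
    set br : ℝ := Real.log (1 / ε) - C - (Real.log M + 1) - ε * (12 * (M : ℝ) ^ 2) with hbr
    have e3 : ε * N / B * br * L = (B * ε⁻¹ ^ 2)⁻¹ * (ε⁻¹ * N * (L * br)) := by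
      field_simp
    have e4 : (B * ε⁻¹ ^ 2)⁻¹ * (B * ε⁻¹ ^ 2 * screwForm M y) = screwForm M y := by
      field_simp
    -- endgame: `c M^{-A} ≤ ε N/B · bracket`
    have hmain' : c * (M : ℝ) ^ (-A) ≤
        ε * N / B * (Real.log (1 / ε) - C - (Real.log M + 1) - ε * (12 * (M : ℝ) ^ 2)) := by
      simpa only [hεdef, hNdef, hBdef] using hmain
    calc c * (M : ℝ) ^ (-A) * ∑ m ∈ Icc 2 M, x m ^ 2
        ≤ c * (M : ℝ) ^ (-A) * L := mul_le_mul_of_nonneg_left hsq hcA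
      _ ≤ ε * N / B * br * L := mul_le_mul_of_nonneg_right hmain' hL0
      _ = (B * ε⁻¹ ^ 2)⁻¹ * (ε⁻¹ * N * (L * br)) := e3
      _ ≤ (B * ε⁻¹ ^ 2)⁻¹ * (B * ε⁻¹ ^ 2 * screwForm M y) :=
          mul_le_mul_of_nonneg_left key (inv_nonneg.2 hBε.le)
      _ = screwForm M y := e4
      _ = ∑ m ∈ Icc 2 M, ∑ m' ∈ Icc 2 M,
            zetaScrewKernel (Real.log m) (Real.log m') * (x m * x m') := hQ

/-- **`FloorOfRH` PROVED** (item stmt-RiemannHypothesis-15762): the polynomial floor under RH. -/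
theorem floorOfRH_proof :
    Summit.RiemannHypothesis.RiemannHypothesis.Theses.IntegerScrew.FloorOfRH :=
  FloorOfRH_of combDominated_proof bumpWitness_proof shadowBudget_proof endgameComb_proof

/-! ## Consequences: the crux `ScrewPolyFloor` is the summit -/

/-- The crux implies `Ψ(log m) ≥ 0` at every integer (diagonal). -/
theorem zetaScrew_log_nonneg_of_screwPolyFloor
    (h : Summit.RiemannHypothesis.RiemannHypothesis.Theses.IntegerScrew.ScrewPolyFloor)
    (m : ℕ) (hm : 1 ≤ m) : 0 ≤ zetaScrew (Real.log m) := by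
  classical
  rcases Nat.lt_or_ge m 2 with hlt | hge
  · have h1 : m = 1 := by omega
    subst h1
    simp [zetaScrew_zero]
  obtain ⟨A, c, hc, hAll⟩ := h
  set x : ℕ → ℝ := fun k => if k = m then 1 else 0 with hx
  have hmem : m ∈ Finset.Icc 2 m := Finset.mem_Icc.mpr ⟨hge, le_rfl⟩
  have h1 := hAll m x
  have hR : ∑ a ∈ Finset.Icc 2 m, ∑ b ∈ Finset.Icc 2 m,
      zetaScrewKernel (Real.log a) (Real.log b) * (x a * x b) =
        zetaScrewKernel (Real.log m) (Real.log m) := by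
    rw [Finset.sum_eq_single m]
    · rw [Finset.sum_eq_single m]
      · simp [hx]
      · intro b _ hb
        simp [hx, hb]
      · intro hnot
        exact absurd hmem hnot
    · intro a _ ha
      apply Finset.sum_eq_zero
      intro b _
      simp [hx, ha]
    · intro hnot
      exact absurd hmem hnot
  have hL0 : 0 ≤ c * (m : ℝ) ^ (-A) * ∑ a ∈ Finset.Icc 2 m, x a ^ 2 :=
    mul_nonneg (mul_nonneg hc.le (Real.rpow_nonneg (Nat.cast_nonneg m) _))
      (Finset.sum_nonneg fun _ _ => sq_nonneg _)
  have h2 : 0 ≤ zetaScrewKernel (Real.log m) (Real.log m) := by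
    rw [← hR]; exact le_trans hL0 h1
  rw [zetaScrewKernel_self] at h2
  linarith

/-- **The crux is RH**: `ScrewPolyFloor ↔ RiemannHypothesis` (→ : diagonal + `DiscreteLandau_proof`;
← : `floorOfRH_proof`). -/
theorem screwPolyFloor_iff_riemannHypothesis :
    Summit.RiemannHypothesis.RiemannHypothesis.Theses.IntegerScrew.ScrewPolyFloor ↔
      _root_.RiemannHypothesis :=
  ⟨fun h => Summit.RiemannHypothesis.RiemannHypothesis.Theorems.IntegerScrewDiscreteLandau.DiscreteLandau_proof
      (zetaScrew_log_nonneg_of_screwPolyFloor h),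
    fun hRH => floorOfRH_proof hRH⟩

/-- RH ⇒ the route target (restriction of Suzuki 2023 Thm 1.2). -/
theorem integerScrewPSD_of_riemannHypothesis (hRH : _root_.RiemannHypothesis) :
    Summit.RiemannHypothesis.RiemannHypothesis.Theses.IntegerScrew.IntegerScrewPSD := by
  intro N t x _
  have h12 : Suzuki2023_thm12 := Suzuki2023_thm12_holds
  have h := h12.1 hRH
  exact (isPosSemidefKernelOn_zetaScrewKernel_iff Set.univ).1 h N t x fun _ => Set.mem_univ _

/-- The route target ⇒ RH (`screwDensityDetection_proof` + Suzuki 2023 Thm 1.2). -/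
theorem riemannHypothesis_of_integerScrewPSD
    (hP : Summit.RiemannHypothesis.RiemannHypothesis.Theses.IntegerScrew.IntegerScrewPSD) :
    _root_.RiemannHypothesis := by
  have hall : ∀ (N : ℕ) (t x : Fin N → ℝ),
      0 ≤ ∑ i, ∑ j, zetaScrewKernel (t i) (t j) * (x i * x j) :=
    Summit.RiemannHypothesis.RiemannHypothesis.Theorems.screwDensityDetection_proof hP
  have hpsd : Literature.Analysis.Complex.IsPosSemidefKernelOn
      (fun t u : ℝ => (zetaScrewKernel t u : ℂ)) Set.univ :=
    (isPosSemidefKernelOn_zetaScrewKernel_iff Set.univ).2 fun N t x _ => hall N t x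
  have h12 : Suzuki2023_thm12 := Suzuki2023_thm12_holds
  exact h12.2 hpsd

/-- **The crux is the route target**: `ScrewPolyFloor ↔ IntegerScrewPSD`. -/
theorem screwPolyFloor_iff_target :
    Summit.RiemannHypothesis.RiemannHypothesis.Theses.IntegerScrew.ScrewPolyFloor ↔
      Summit.RiemannHypothesis.RiemannHypothesis.Theses.IntegerScrew.IntegerScrewPSD :=
  ⟨fun h => integerScrewPSD_of_riemannHypothesis (screwPolyFloor_iff_riemannHypothesis.1 h),
    fun hP => screwPolyFloor_iff_riemannHypothesis.2 (riemannHypothesis_of_integerScrewPSD hP)⟩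

end Summit.RiemannHypothesis.RiemannHypothesis.Theorems.IntegerScrewFloorOfRH

end
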